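import Mathlib.Probability.ProbabilityMassFunction.Integrals
import Mathlib.Probability.Distributions.Uniform
import Mathlib.MeasureTheory.Integral.Bochner.Basic
import Mathlib.Algebra.Order.BigOperators.Ring.Finset
import Mathlib.Algebra.Ring.GeomSum
import Literature.ComputerArithmetic.ElararEtAl2023.VarianceBounds
import Literature.ComputerArithmetic.ConnollyHighamMary2021.ProductLemmas
import Literature.ComputerArithmetic.HallmanIpsen2023.MartingaleBounds
import HarnessLib

/-!
# El Arar–Sohier–de Oliveira Castro–Petit 2023: the variance / Bienaymé–Chebyshev / Azuma–Hoeffding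
# bounds PROVED in the SR error model

HONEST FRAMING: shared numerical engines serving client cells; rigour lives in the verifiers; every
published number belongs to a client cell's ledger, not to the engines group.

Source: E.-M. El Arar, D. Sohier, P. de Oliveira Castro, E. Petit, *Stochastic rounding variance and
probabilistic bounds: a new approach*, SIAM J. Sci. Comput. 45(5) (2023) C255–C275
[cite: ArarEtAl2023]; proofs read from arXiv:2207.10321 (Lemma 3.1 and Theorems 3.2, 3.5 with their
proofs on printed pp. 5–8; Lemma 4.4, Theorem 4.5 with its proof and §4.2 eqs. (4.4)/(4.5) on printed
pp. 11–14 of the preprint = PDF pp. 22–27 of the materialised text).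

This file DISCHARGES the named facts of `ElararEtAl2023.VarianceBounds` over the SR error model
`ConnollyHighamMary2021.SRErrorModel μ u δ` (measurable, `|δₖ| ≤ u`, mean independent in index
order), reusing the proved Lemma 3.1(1),(3) (`productMeanOne_holds`, `productVarianceBound_holds`)
and Hallman–Ipsen's Azuma–Hoeffding inequality for predictable martingale transforms
(`HallmanIpsen2023.azumaHoeffding`):

* `innerProductUnbiased_holds`, `hornerUnbiased_holds` — Theorems 3.2 / 3.5, first parts
  (linearity + Lemma 3.1(1));
* `innerProductVarianceBound_holds`, `hornerVarianceBound_holds` — eqs. (3.1) / (3.2): the error is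
  `Σᵢ cᵢ (ψ_{Kᵢ} − 1)`, the weighted Cauchy–Schwarz inequality `(Σ cᵢXᵢ)² ≤ (Σ|cᵢ|)(Σ|cᵢ|Xᵢ²)` and
  Lemma 3.1(3) with `|Kᵢ| ≤ n` (resp. `≤ 2n`) give the multiplied-out bounds (this is the source's
  `σ(X+Y) ≤ σ(X)+σ(Y)` argument written pointwise);
* `innerProductBoundBC_holds`, `hornerBoundBC_holds` — eqs. (4.4) / (4.5) by Markov's inequality on
  the squared error (the Bienaymé–Chebyshev step of §4.2);
* `hornerBoundAH_holds` — Theorem 4.5: the error `P̂(x) − P(x) = Σ_{k=1}^{2n} T_k δ_k` is a martingale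
  transform with predictable coefficients `|T_k| ≤ (1+u)^{k−1} Σ|aᵢxⁱ|` (the source's `Cᵢ`, here
  WITHOUT dividing by powers of `x`, so `x = 0` needs no case split), and
  `Σ_{k=1}^{2n} ((1+u)^{k−1}u)² = uγ_{4n}(u)/(2+u) ≤ uγ_{4n}(u)/2`, so the Azuma–Hoeffding radius
  `√(Σc_k²)√(2 ln(2/λ))` is at most `Σ|aᵢxⁱ| √(uγ_{4n}(u)) √(ln(2/λ))`.

All four mechanisms are proved once for a general "recursive sum" `Σ_{i∈I} cᵢ ∏_{k∈Kᵢ}(1+δₖ)`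
(`integral_sum_mul_prod`, `integral_errSq_le`, `measure_err_gt_le_BC`, `measure_err_gt_le_AH`) and
then specialised (`ipComputed_eq_sum_prod` rewrites the §3.1 inner product in that shape).

**Lemma 3.1(2) and an erratum on its transcription.** The named fact `productCovarianceBound`
quantifies over EVERY `u : ℝ`, but the published lemma lives in the floating-point setting where
`u` is the unit roundoff (`u ≤ 1`, so `1 + δₖ ≥ 0`). We prove the lemma under `u ≤ 1`
(`productCovarianceBound_of_le_one`, the source's induction on `m = |K ∩ K'|`), and we prove that the
unrestricted transcription is FALSE (`not_productCovarianceBound`): for `u = 2` a four-point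
mean-independent model with `δ₀ = ±2` and `δ₁ = ±2` on `{δ₀ = −2}`, `δ₁ = 0` on `{δ₀ = 2}` gives
`E[(1+δ₀)(1+δ₁)²] = −1 < 1` for `K = {0,1}`, `K' = {1}`. Hence nobody should use
`productCovarianceBound` as a hypothesis; use `productCovarianceBound_of_le_one`.
-/

namespace Literature.ComputerArithmetic.ElararEtAl2023

open _root_.MeasureTheory _root_.ProbabilityTheory
open Finset
open Literature.ComputerArithmetic.ConnollyHighamMary2021 (SRErrorModel gammaSq productMeanOne_holds
  productVarianceBound_holds recursiveSumUnbiased_holds)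
open Literature.ComputerArithmetic.ElararEtAl2026 (gammaFn hornerComputed)
open Literature.ComputerArithmetic.HallmanIpsen2023 (clip IsPredictable transform azumaRadius
  azumaHoeffding u_nonneg integral_rep_mul_eq_zero)

section Model

variable {Ω : Type} [MeasurableSpace Ω] {μ : Measure Ω} {u : ℝ} {δ : ℕ → Ω → ℝ}

/-! ### Bounded measurable functionals of the errors (plumbing) -/

/-- [folklore] a measurable function with a sure bound is integrable on a finite measure space. -/
private theorem integrable_of_abs_le [IsFiniteMeasure μ] {f : Ω → ℝ} (hf : Measurable f) {C : ℝ}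
    (hC : ∀ ω, |f ω| ≤ C) : Integrable f μ :=
  Integrable.of_mem_Icc (-C) C hf.aemeasurable (ae_of_all _ fun ω => abs_le.mp (hC ω))

/-- [folklore] measurability of `ψ_K = ∏_{k∈K}(1 + δₖ)`. -/
private theorem measurable_prod (h : SRErrorModel μ u δ) (K : Finset ℕ) :
    Measurable (fun ω => ∏ k ∈ K, (1 + δ k ω)) :=
  Finset.measurable_prod K (fun k _ => (h.measurable k).const_add 1)

/-- [folklore] `|ψ_K| ≤ (1 + u)^{|K|}`. -/
private theorem abs_prod_le (h : SRErrorModel μ u δ) (K : Finset ℕ) (ω : Ω) :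
    |∏ k ∈ K, (1 + δ k ω)| ≤ (1 + u) ^ K.card := by
  rw [Finset.abs_prod]
  calc ∏ k ∈ K, |1 + δ k ω| ≤ ∏ _k ∈ K, (1 + u) :=
        Finset.prod_le_prod (fun _ _ => abs_nonneg _) (fun k _ =>
          (abs_add_le 1 (δ k ω)).trans (by rw [abs_one]; linarith [h.bounded k ω]))
    _ = (1 + u) ^ K.card := Finset.prod_const _

/-- [folklore] `|ψ_K − 1| ≤ (1 + u)^{|K|} + 1`. -/
private theorem abs_prod_sub_one_le (h : SRErrorModel μ u δ) (K : Finset ℕ) (ω : Ω) :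
    |(∏ k ∈ K, (1 + δ k ω)) - 1| ≤ (1 + u) ^ K.card + 1 :=
  (abs_sub _ _).trans (by rw [abs_one]; linarith [abs_prod_le h K ω])

/-- [folklore] integrability of `(ψ_K − 1)²`. -/
private theorem integrable_prod_sub_one_sq [IsFiniteMeasure μ] (h : SRErrorModel μ u δ)
    (K : Finset ℕ) : Integrable (fun ω => ((∏ k ∈ K, (1 + δ k ω)) - 1) ^ 2) μ := by
  refine integrable_of_abs_le (((measurable_prod h K).sub_const 1).pow_const 2)
    (C := ((1 + u) ^ K.card + 1) ^ 2) (fun ω => ?_)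
  rw [abs_pow]
  exact pow_le_pow_left₀ (abs_nonneg _) (abs_prod_sub_one_le h K ω) 2

/-- [folklore] `γ_m(u²) ≤ γ_N(u²)` for `m ≤ N`. -/
private theorem gammaSq_mono {m N : ℕ} (hmN : m ≤ N) (u : ℝ) : gammaSq m u ≤ gammaSq N u := by
  unfold gammaSq
  have h1 : (1 : ℝ) ≤ 1 + u ^ 2 := by nlinarith [sq_nonneg u]
  linarith [pow_le_pow_right₀ h1 hmN]

/-- [folklore] `0 ≤ γ_N(u²)`. -/
private theorem gammaSq_nonneg (N : ℕ) (u : ℝ) : 0 ≤ gammaSq N u := by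
  have := gammaSq_mono (Nat.zero_le N) u
  simp only [gammaSq, pow_zero, sub_self] at this ⊢
  linarith

/-- **Mean independence for functionals of the past, cube version.** For a measurable `F` depending
only on the coordinates `< m` and bounded on the cube `{v | ∀ j, |v j| ≤ u}`,
`E[F(δ) · δ_m] = 0` (clip the coordinates into `[−u, u]`, which changes nothing on `δ`, and apply the
model's mean independence). [cite: ArarEtAl2023, Def. 2.1 / Lemma 2.3 (mean independence implies
`E[δ_k | δ_1, …, δ_{k−1}] = 0`)] -/
theorem integral_pastFn_mul_eq_zero (h : SRErrorModel μ u δ) (hu : 0 ≤ u) (m : ℕ)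
    {F : (ℕ → ℝ) → ℝ} (hF : Measurable F) (hdep : DependsOn F (Set.Iio m))
    (hbd : ∃ C, ∀ v : ℕ → ℝ, (∀ j, |v j| ≤ u) → |F v| ≤ C) :
    ∫ ω, F (fun i => δ i ω) * δ m ω ∂μ = 0 := by
  set G : (ℕ → ℝ) → ℝ := fun v => F (fun j => clip u (v j)) with hG
  have hclip_le : ∀ t, |clip u t| ≤ u := fun t =>
    abs_le.mpr ⟨le_max_left _ _, max_le (by linarith) (min_le_right _ _)⟩
  have hclip_id : ∀ t, |t| ≤ u → clip u t = t := fun t ht => by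
    rw [abs_le] at ht
    unfold clip
    rw [min_eq_left ht.2, max_eq_right ht.1]
  have hclip_meas : Measurable (clip u) := by
    unfold clip; exact measurable_const.max (measurable_id.min measurable_const)
  have hGm : Measurable G :=
    hF.comp (measurable_pi_lambda _ (fun j => hclip_meas.comp (measurable_pi_apply j)))
  have hGdep : DependsOn G (Set.Iio m) := by
    intro v w hvw
    rw [hG]
    refine hdep (fun j hj => ?_)
    simp only [hvw j hj]
  have hGbd : ∃ C, ∀ v, |G v| ≤ C := by
    obtain ⟨C, hC⟩ := hbd
    exact ⟨C, fun v => hC _ (fun j => hclip_le _)⟩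
  have key := integral_rep_mul_eq_zero h m hGm hGdep hGbd
  have hGδ : ∀ ω, G (fun i => δ i ω) = F (fun i => δ i ω) := by
    intro ω
    rw [hG]
    dsimp only
    congr 1
    funext j
    exact hclip_id _ (h.bounded j ω)
  simp_rw [hGδ] at key
  exact key

/-! ### The general recursive sum `Σ_{i∈I} cᵢ ψ_{Kᵢ}`: mean, variance, Bienaymé–Chebyshev -/

variable [IsProbabilityMeasure μ]

/-- [folklore] the error of a recursive sum is `Σ cᵢ(ψ_{Kᵢ} − 1)`. -/
private theorem err_eq {ι : Type*} (I : Finset ι) (c : ι → ℝ) (K : ι → Finset ℕ) (e : ℕ → ℝ) :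
    (∑ i ∈ I, c i * ∏ k ∈ K i, (1 + e k)) - ∑ i ∈ I, c i
      = ∑ i ∈ I, c i * ((∏ k ∈ K i, (1 + e k)) - 1) := by
  rw [← Finset.sum_sub_distrib]
  exact Finset.sum_congr rfl (fun i _ => by ring)

/-- **Lemma 3.1(1) summed (the mechanism of Thms. 3.2/3.5, first parts):**
`E Σ_{i∈I} cᵢ ψ_{Kᵢ} = Σ_{i∈I} cᵢ`. [cite: ArarEtAl2023, Lemma 3.1(1); Thm. 3.2 proof] -/
theorem integral_sum_mul_prod (h : SRErrorModel μ u δ) {ι : Type*} (I : Finset ι) (c : ι → ℝ)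
    (K : ι → Finset ℕ) :
    ∫ ω, ∑ i ∈ I, c i * ∏ k ∈ K i, (1 + δ k ω) ∂μ = ∑ i ∈ I, c i := by
  rw [integral_finsetSum _ (fun i _ =>
    (integrable_of_abs_le (measurable_prod h (K i)) (abs_prod_le h (K i))).const_mul (c i))]
  refine Finset.sum_congr rfl (fun i _ => ?_)
  rw [integral_const_mul, productMeanOne_holds Ω μ u δ h (K i), mul_one]

/-- [folklore] **weighted Cauchy–Schwarz**: `(Σ cᵢXᵢ)² ≤ (Σ|cᵢ|)·Σ|cᵢ|Xᵢ²`. -/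
private theorem sq_sum_mul_le {ι : Type*} (I : Finset ι) (c X : ι → ℝ) :
    (∑ i ∈ I, c i * X i) ^ 2 ≤ (∑ i ∈ I, |c i|) * ∑ i ∈ I, |c i| * X i ^ 2 :=
  Finset.sum_sq_le_sum_mul_sum_of_sq_le_mul I (fun _ _ => abs_nonneg _)
    (fun _ _ => mul_nonneg (abs_nonneg _) (sq_nonneg _))
    (fun i _ => by rw [mul_pow, ← sq_abs (c i)]; ring_nf; rfl)

/-- **Eqs. (3.1)/(3.2), general form:** if every `|Kᵢ| ≤ N` then
`E(Σ cᵢψ_{Kᵢ} − Σ cᵢ)² ≤ (Σ|cᵢ|)² γ_N(u²)` — the source's `V(Σ cᵢψᵢ) ≤ (Σ|cᵢ|σ(ψᵢ))²` with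
`V(ψᵢ) ≤ γ_{|Kᵢ|}(u²) ≤ γ_N(u²)` (Lemma 3.1(3), `γ` increasing), obtained here from the pointwise
weighted Cauchy–Schwarz inequality. [cite: ArarEtAl2023, Thm. 3.2 proof (eq. (3.1)); Thm. 3.5 proof] -/
theorem integral_errSq_le (h : SRErrorModel μ u δ) {ι : Type*} (I : Finset ι) (c : ι → ℝ)
    (K : ι → Finset ℕ) {N : ℕ} (hN : ∀ i ∈ I, (K i).card ≤ N) :
    ∫ ω, ((∑ i ∈ I, c i * ∏ k ∈ K i, (1 + δ k ω)) - ∑ i ∈ I, c i) ^ 2 ∂μ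
      ≤ (∑ i ∈ I, |c i|) ^ 2 * gammaSq N u := by
  have hpt : ∀ ω, ((∑ i ∈ I, c i * ∏ k ∈ K i, (1 + δ k ω)) - ∑ i ∈ I, c i) ^ 2
      ≤ (∑ i ∈ I, |c i|) * ∑ i ∈ I, |c i| * ((∏ k ∈ K i, (1 + δ k ω)) - 1) ^ 2 := by
    intro ω
    rw [err_eq]
    exact sq_sum_mul_le I c _
  have hint : Integrable
      (fun ω => (∑ i ∈ I, |c i|) * ∑ i ∈ I, |c i| * ((∏ k ∈ K i, (1 + δ k ω)) - 1) ^ 2) μ :=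
    (integrable_finsetSum _ (fun i _ => (integrable_prod_sub_one_sq h (K i)).const_mul _)).const_mul _
  calc ∫ ω, ((∑ i ∈ I, c i * ∏ k ∈ K i, (1 + δ k ω)) - ∑ i ∈ I, c i) ^ 2 ∂μ
      ≤ ∫ ω, (∑ i ∈ I, |c i|) * ∑ i ∈ I, |c i| * ((∏ k ∈ K i, (1 + δ k ω)) - 1) ^ 2 ∂μ :=
        integral_mono_of_nonneg (ae_of_all _ (fun ω => sq_nonneg _)) hint (ae_of_all _ hpt)
    _ = (∑ i ∈ I, |c i|) * ∑ i ∈ I, |c i| * ∫ ω, ((∏ k ∈ K i, (1 + δ k ω)) - 1) ^ 2 ∂μ := by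
        rw [integral_const_mul, integral_finsetSum _ (fun i _ =>
          (integrable_prod_sub_one_sq h (K i)).const_mul _)]
        congr 1
        exact Finset.sum_congr rfl (fun i _ => integral_const_mul _ _)
    _ ≤ (∑ i ∈ I, |c i|) * ∑ i ∈ I, |c i| * gammaSq N u := by
        refine mul_le_mul_of_nonneg_left (Finset.sum_le_sum (fun i hi =>
          mul_le_mul_of_nonneg_left ?_ (abs_nonneg _))) (Finset.sum_nonneg (fun _ _ => abs_nonneg _))
        exact (productVarianceBound_holds Ω μ u δ h (K i)).trans (gammaSq_mono (hN i hi) u)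
    _ = (∑ i ∈ I, |c i|) ^ 2 * gammaSq N u := by rw [← Finset.sum_mul]; ring

/-- [folklore] the squared error is integrable (bounded and measurable). -/
private theorem integrable_errSq (h : SRErrorModel μ u δ) {ι : Type*} (I : Finset ι) (c : ι → ℝ)
    (K : ι → Finset ℕ) :
    Integrable (fun ω => ((∑ i ∈ I, c i * ∏ k ∈ K i, (1 + δ k ω)) - ∑ i ∈ I, c i) ^ 2) μ := by
  have hm : Measurable (fun ω => (∑ i ∈ I, c i * ∏ k ∈ K i, (1 + δ k ω)) - ∑ i ∈ I, c i) :=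
    (Finset.measurable_sum I (fun i _ => (measurable_prod h (K i)).const_mul (c i))).sub_const _
  refine integrable_of_abs_le (hm.pow_const 2)
    (C := (∑ i ∈ I, |c i| * ((1 + u) ^ (K i).card + 1)) ^ 2) (fun ω => ?_)
  rw [abs_pow]
  refine pow_le_pow_left₀ (abs_nonneg _) ?_ 2
  rw [err_eq]
  refine (Finset.abs_sum_le_sum_abs _ _).trans (Finset.sum_le_sum (fun i _ => ?_))
  rw [abs_mul]
  exact mul_le_mul_of_nonneg_left (abs_prod_sub_one_le h (K i) ω) (abs_nonneg _)

/-- **§4.2 (Bienaymé–Chebyshev), general form:** if every `|Kᵢ| ≤ N` then for `0 < λ`,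
`|Σ cᵢψ_{Kᵢ} − Σ cᵢ| ≤ (Σ|cᵢ|)√(γ_N(u²)/λ)` with probability at least `1 − λ` (Markov's inequality
applied to the squared error, whose mean is at most `(Σ|cᵢ|)²γ_N(u²)`).
[cite: ArarEtAl2023, §4.2, eqs. (4.4)/(4.5)] -/
theorem measure_err_gt_le_BC (h : SRErrorModel μ u δ) {ι : Type*} (I : Finset ι) (c : ι → ℝ)
    (K : ι → Finset ℕ) {N : ℕ} (hN : ∀ i ∈ I, (K i).card ≤ N) {lam : ℝ} (hlam : 0 < lam) :
    μ {ω | (∑ i ∈ I, |c i|) * Real.sqrt (gammaSq N u / lam)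
        < |(∑ i ∈ I, c i * ∏ k ∈ K i, (1 + δ k ω)) - ∑ i ∈ I, c i|} ≤ ENNReal.ofReal lam := by
  set S := ∑ i ∈ I, |c i| with hS
  set t := S * Real.sqrt (gammaSq N u / lam) with ht
  have hV := integral_errSq_le h I c K hN
  have hEi := integrable_errSq h I c K
  have hS0 : 0 ≤ S := Finset.sum_nonneg (fun _ _ => abs_nonneg _)
  have hγ := gammaSq_nonneg N u
  have ht0 : 0 ≤ t := mul_nonneg hS0 (Real.sqrt_nonneg _)
  have ht2 : t ^ 2 = S ^ 2 * gammaSq N u / lam := by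
    rw [ht, mul_pow, Real.sq_sqrt (div_nonneg hγ hlam.le)]; ring
  rw [← ofReal_measureReal]
  refine ENNReal.ofReal_le_ofReal ?_
  by_cases hV0 : S ^ 2 * gammaSq N u = 0
  · -- degenerate radius: the squared error has mean zero, hence vanishes almost surely
    have hint0 : ∫ ω, ((∑ i ∈ I, c i * ∏ k ∈ K i, (1 + δ k ω)) - ∑ i ∈ I, c i) ^ 2 ∂μ = 0 :=
      le_antisymm (hV.trans (le_of_eq hV0)) (integral_nonneg (fun _ => sq_nonneg _))
    have hae := (integral_eq_zero_iff_of_nonneg (fun _ => sq_nonneg _) hEi).mp hint0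
    have hnull : μ {ω | t < |(∑ i ∈ I, c i * ∏ k ∈ K i, (1 + δ k ω)) - ∑ i ∈ I, c i|} = 0 := by
      refine measure_mono_null (fun ω hω => ?_) (ae_iff.mp hae)
      simp only [Set.mem_setOf_eq] at hω ⊢
      have hpos : 0 < |(∑ i ∈ I, c i * ∏ k ∈ K i, (1 + δ k ω)) - ∑ i ∈ I, c i| :=
        lt_of_le_of_lt ht0 hω
      exact pow_ne_zero 2 (abs_pos.mp hpos)
    rw [measureReal_def, hnull, ENNReal.toReal_zero]
    exact hlam.le
  · have hVpos : 0 < S ^ 2 * gammaSq N u :=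
      lt_of_le_of_ne (mul_nonneg (sq_nonneg _) hγ) (Ne.symm hV0)
    have htpos : 0 < t ^ 2 := by rw [ht2]; exact div_pos hVpos hlam
    have hM := mul_meas_ge_le_integral_of_nonneg (ae_of_all _ (fun ω => sq_nonneg
      ((∑ i ∈ I, c i * ∏ k ∈ K i, (1 + δ k ω)) - ∑ i ∈ I, c i))) hEi (t ^ 2)
    have hsub : {ω | t < |(∑ i ∈ I, c i * ∏ k ∈ K i, (1 + δ k ω)) - ∑ i ∈ I, c i|}
        ⊆ {ω | t ^ 2 ≤ ((∑ i ∈ I, c i * ∏ k ∈ K i, (1 + δ k ω)) - ∑ i ∈ I, c i) ^ 2} := by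
      intro ω hω
      simp only [Set.mem_setOf_eq] at hω ⊢
      have := pow_le_pow_left₀ ht0 hω.le 2
      rwa [sq_abs] at this
    calc μ.real {ω | t < |(∑ i ∈ I, c i * ∏ k ∈ K i, (1 + δ k ω)) - ∑ i ∈ I, c i|}
        ≤ μ.real {ω | t ^ 2 ≤ ((∑ i ∈ I, c i * ∏ k ∈ K i, (1 + δ k ω)) - ∑ i ∈ I, c i) ^ 2} :=
          measureReal_mono hsub
      _ ≤ (∫ ω, ((∑ i ∈ I, c i * ∏ k ∈ K i, (1 + δ k ω)) - ∑ i ∈ I, c i) ^ 2 ∂μ) / t ^ 2 := by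
          rw [le_div_iff₀ htpos, mul_comm]; exact hM
      _ ≤ (S ^ 2 * gammaSq N u) / t ^ 2 := div_le_div_of_nonneg_right hV htpos.le
      _ = lam := by rw [ht2, div_div_eq_mul_div, mul_div_cancel_left₀ _ (ne_of_gt hVpos)]

/-! ### The general recursive sum: martingale representation and Azuma–Hoeffding (Thm. 4.5) -/

/-- The predictable coefficient of `δ_k` in the error `Σ cᵢ(ψ_{Kᵢ} − 1)`:
`T_k(v) = Σ_{i : k ∈ Kᵢ} cᵢ ∏_{j∈Kᵢ, j<k}(1 + v_j)` — the source's increments `Cᵢδᵢ` of the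
martingale `Z₁, …, Z_{2n}` (proof of Theorem 4.5), written for a general recursive sum.
[cite: ArarEtAl2023, Thm. 4.5 proof (Lemma 4.4: `Z_i = Z_{i−1} + C_i δ_i`)] -/
def ahCoef {ι : Type*} (I : Finset ι) (c : ι → ℝ) (K : ι → Finset ℕ) (k : ℕ) (v : ℕ → ℝ) : ℝ :=
  ∑ i ∈ I with k ∈ K i, c i * ∏ j ∈ K i with j < k, (1 + v j)

omit [MeasurableSpace Ω] [IsProbabilityMeasure μ] in
/-- **The error is a martingale transform:** if every `Kᵢ ⊆ [1, M]` then
`Σ cᵢψ_{Kᵢ} − Σ cᵢ = Σ_{k ≤ M} T_k(δ) δ_k` (telescoping `ψ_K − 1 = Σ_{k∈K} δ_k ∏_{j∈K,j<k}(1+δ_j)`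
and exchanging the sums). [cite: ArarEtAl2023, Lemma 4.4 / Thm. 4.5 proof] -/
theorem err_eq_transform {ι : Type*} (I : Finset ι) (c : ι → ℝ) (K : ι → Finset ℕ) {M : ℕ}
    (hM : ∀ i ∈ I, K i ⊆ Icc 1 M) (ω : Ω) :
    (∑ i ∈ I, c i * ∏ k ∈ K i, (1 + δ k ω)) - ∑ i ∈ I, c i
      = transform (fun k ω => ahCoef I c K k (fun j => δ j ω)) δ (M + 1) ω := by
  rw [err_eq, transform]
  have htel : ∀ i ∈ I, c i * ((∏ k ∈ K i, (1 + δ k ω)) - 1)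
      = ∑ k ∈ K i, c i * (δ k ω * ∏ j ∈ K i with j < k, (1 + δ j ω)) := by
    intro i _
    rw [Finset.prod_one_add_ordered, add_sub_cancel_left, Finset.mul_sum]
  rw [Finset.sum_congr rfl htel]
  rw [Finset.sum_comm' (t' := range (M + 1)) (s' := fun k => I.filter (fun i => k ∈ K i))]
  · refine Finset.sum_congr rfl (fun k _ => ?_)
    rw [ahCoef, Finset.sum_mul]
    exact Finset.sum_congr rfl (fun i _ => by ring)
  · intro i k
    simp only [Finset.mem_filter, Finset.mem_range]
    constructor
    · rintro ⟨hi, hk⟩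
      have := Finset.mem_Icc.mp (hM i hi hk)
      exact ⟨⟨hi, hk⟩, by omega⟩
    · rintro ⟨⟨hi, hk⟩, _⟩
      exact ⟨hi, hk⟩

omit [MeasurableSpace Ω] [IsProbabilityMeasure μ] in
/-- **The coefficients are predictable** (`T_k` is a measurable function of `δ_j`, `j < k`).
[cite: ArarEtAl2023, Lemma 4.4 (the `Z_i` form a martingale w.r.t. `δ_1, …, δ_i`)] -/
theorem isPredictable_ahCoef {ι : Type*} (I : Finset ι) (c : ι → ℝ) (K : ι → Finset ℕ) :
    IsPredictable δ (fun k ω => ahCoef I c K k (fun j => δ j ω)) := by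
  intro k
  refine ⟨ahCoef I c K k, ?_, ?_, fun ω => rfl⟩
  · unfold ahCoef
    exact Finset.measurable_sum _ (fun i _ => (Finset.measurable_prod _
      (fun j _ => (measurable_pi_apply j).const_add 1)).const_mul (c i))
  · intro v w hvw
    unfold ahCoef
    refine Finset.sum_congr rfl (fun i _ => ?_)
    congr 1
    refine Finset.prod_congr rfl (fun j hj => ?_)
    rw [hvw j (Set.mem_Iio.mpr (Finset.mem_filter.mp hj).2)]

/-- The sure bounds on the coefficients: `A_0 = 0`, `A_k = (Σ|cᵢ|)(1+u)^{k−1}` (`k ≥ 1`) — the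
source's `|Cᵢ| ≤ (1+u)^{i−1} Σ|a_jx^j|` up to the powers of `x` it divides out.
[cite: ArarEtAl2023, Thm. 4.5 proof (bounds on `C_i`)] -/
noncomputable def ahBound (S u : ℝ) (k : ℕ) : ℝ := if k = 0 then 0 else S * (1 + u) ^ (k - 1)

omit [IsProbabilityMeasure μ] in
/-- **`|T_k(δ)| ≤ A_k` surely** when every `Kᵢ ⊆ [1, M]`: for `k ∈ Kᵢ` the partial product has at
most `k − 1` factors, each of modulus `≤ 1 + u`. [cite: ArarEtAl2023, Thm. 4.5 proof] -/
theorem abs_ahCoef_le (h : SRErrorModel μ u δ) (hu : 0 ≤ u) {ι : Type*} (I : Finset ι) (c : ι → ℝ)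
    (K : ι → Finset ℕ) {M : ℕ} (hM : ∀ i ∈ I, K i ⊆ Icc 1 M) (k : ℕ) (ω : Ω) :
    |ahCoef I c K k (fun j => δ j ω)| ≤ ahBound (∑ i ∈ I, |c i|) u k := by
  unfold ahCoef ahBound
  by_cases hk : k = 0
  · subst hk
    rw [if_pos rfl]
    have hempty : I.filter (fun i => 0 ∈ K i) = ∅ := by
      refine Finset.filter_false_of_mem (fun i hi h0 => ?_)
      have := Finset.mem_Icc.mp (hM i hi h0)
      omega
    rw [hempty, Finset.sum_empty, abs_zero]
  · rw [if_neg hk]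
    have h1u : (1 : ℝ) ≤ 1 + u := by linarith
    calc |∑ i ∈ I with k ∈ K i, c i * ∏ j ∈ K i with j < k, (1 + δ j ω)|
        ≤ ∑ i ∈ I with k ∈ K i, |c i * ∏ j ∈ K i with j < k, (1 + δ j ω)| :=
          Finset.abs_sum_le_sum_abs _ _
      _ ≤ ∑ i ∈ I with k ∈ K i, |c i| * (1 + u) ^ (k - 1) := by
          refine Finset.sum_le_sum (fun i hi => ?_)
          rw [abs_mul]
          refine mul_le_mul_of_nonneg_left ?_ (abs_nonneg _)
          have hiI : i ∈ I := (Finset.mem_filter.mp hi).1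
          have hcard : ((K i).filter (fun j => j < k)).card ≤ k - 1 := by
            calc ((K i).filter (fun j => j < k)).card ≤ (Icc 1 (k - 1)).card :=
                  Finset.card_le_card (fun j hj => by
                    have hj' := Finset.mem_filter.mp hj
                    have := Finset.mem_Icc.mp (hM i hiI hj'.1)
                    exact Finset.mem_Icc.mpr ⟨this.1, by omega⟩)
              _ = k - 1 := by rw [Nat.card_Icc]; omega
          calc |∏ j ∈ K i with j < k, (1 + δ j ω)|
              ≤ (1 + u) ^ ((K i).filter (fun j => j < k)).card := abs_prod_le h _ ω
            _ ≤ (1 + u) ^ (k - 1) := pow_le_pow_right₀ h1u hcard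
      _ ≤ ∑ i ∈ I, |c i| * (1 + u) ^ (k - 1) :=
          Finset.sum_le_sum_of_subset_of_nonneg (Finset.filter_subset _ _)
            (fun i _ _ => mul_nonneg (abs_nonneg _) (pow_nonneg (by linarith) _))
      _ = (∑ i ∈ I, |c i|) * (1 + u) ^ (k - 1) := by rw [Finset.sum_mul]

/-- **The sum of squared increment bounds:** `2 Σ_{k≤M} (A_k u)² ≤ S² u γ_{2M}(u)`, from
`Σ_{k=1}^{M} (1+u)^{2(k−1)} ((1+u)² − 1) = (1+u)^{2M} − 1` and `2u ≤ u² + 2u`; the source computes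
`Σ_{i=1}^{2n} u²(1+u)^{2(i−1)} = u²γ_{4n}(u)/(u²+2u) ≤ uγ_{4n}(u)/2`.
[cite: ArarEtAl2023, Thm. 4.5 proof (display before eq. (4.3))] -/
theorem two_mul_sum_ahBound_sq_le {S u : ℝ} (hu : 0 ≤ u) (M : ℕ) :
    2 * ∑ k ∈ range (M + 1), (ahBound S u k * u) ^ 2 ≤ S ^ 2 * (u * gammaFn (2 * M) u) := by
  have hsum : ∑ k ∈ range (M + 1), (ahBound S u k * u) ^ 2
      = S ^ 2 * u ^ 2 * ∑ k ∈ range M, ((1 + u) ^ 2) ^ k := by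
    rw [Finset.sum_range_succ', Finset.mul_sum]
    simp only [ahBound, Nat.succ_ne_zero, if_false, Nat.add_sub_cancel, if_true, zero_mul,
      zero_pow two_ne_zero, add_zero]
    exact Finset.sum_congr rfl (fun k _ => by rw [← pow_mul, mul_comm 2 k, pow_mul]; ring)
  have hgeom : (∑ k ∈ range M, ((1 + u) ^ 2) ^ k) * ((1 + u) ^ 2 - 1) = gammaFn (2 * M) u := by
    rw [geom_sum_mul, ← pow_mul, gammaFn]
  have hG : 0 ≤ ∑ k ∈ range M, ((1 + u) ^ 2) ^ k :=
    Finset.sum_nonneg (fun _ _ => pow_nonneg (sq_nonneg _) _)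
  rw [hsum, ← hgeom]
  have hS : 0 ≤ S ^ 2 := sq_nonneg S
  nlinarith [mul_nonneg (mul_nonneg hS (pow_nonneg hu 3)) hG]

/-- **The Azuma–Hoeffding radius is below the Theorem 4.5 envelope:**
`√(Σ(A_ku)²) √(2 ln(2/λ)) ≤ S √(uγ_{2M}(u)) √(ln(2/λ))`. [cite: ArarEtAl2023, Thm. 4.5, eq. (4.3)] -/
theorem azumaRadius_le_envelope {S u : ℝ} (hS : 0 ≤ S) (hu : 0 ≤ u) (M : ℕ) (lam : ℝ) :
    azumaRadius (∑ k ∈ range (M + 1), (ahBound S u k * u) ^ 2) lam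
      ≤ S * (Real.sqrt (u * gammaFn (2 * M) u) * Real.sqrt (Real.log (2 / lam))) := by
  set σsq := ∑ k ∈ range (M + 1), (ahBound S u k * u) ^ 2 with hσ
  have h2 := two_mul_sum_ahBound_sq_le (S := S) hu M
  have hL : 0 ≤ Real.sqrt (Real.log (2 / lam)) := Real.sqrt_nonneg _
  have hrad : azumaRadius σsq lam = Real.sqrt (2 * σsq) * Real.sqrt (Real.log (2 / lam)) := by
    rw [azumaRadius, Real.sqrt_mul (by norm_num : (0:ℝ) ≤ 2) (Real.log (2 / lam)),
      Real.sqrt_mul (by norm_num : (0:ℝ) ≤ 2) σsq]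
    ring
  have henv : S * Real.sqrt (u * gammaFn (2 * M) u) = Real.sqrt (S ^ 2 * (u * gammaFn (2 * M) u)) := by
    rw [Real.sqrt_mul (sq_nonneg S), Real.sqrt_sq hS]
  rw [hrad, ← mul_assoc, henv]
  exact mul_le_mul_of_nonneg_right (Real.sqrt_le_sqrt (by rw [hσ]; linarith)) hL

/-- **Theorem 4.5, general form (Azuma–Hoeffding for a recursive sum):** if every `Kᵢ ⊆ [1, M]`
then for `0 < λ`, `|Σ cᵢψ_{Kᵢ} − Σ cᵢ| ≤ (Σ|cᵢ|) √(uγ_{2M}(u)) √(ln(2/λ))` with probability at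
least `1 − λ`. [cite: ArarEtAl2023, Thm. 4.5 (proof via Lemma 4.2 / Lemma 4.4)] -/
theorem measure_err_gt_le_AH (h : SRErrorModel μ u δ) {ι : Type*} (I : Finset ι) (c : ι → ℝ)
    (K : ι → Finset ℕ) {M : ℕ} (hM : ∀ i ∈ I, K i ⊆ Icc 1 M) {lam : ℝ} (hlam : 0 < lam) :
    μ {ω | (∑ i ∈ I, |c i|) * (Real.sqrt (u * gammaFn (2 * M) u) * Real.sqrt (Real.log (2 / lam)))
        < |(∑ i ∈ I, c i * ∏ k ∈ K i, (1 + δ k ω)) - ∑ i ∈ I, c i|} ≤ ENNReal.ofReal lam := by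
  have hu : 0 ≤ u := u_nonneg h
  have hS : 0 ≤ ∑ i ∈ I, |c i| := Finset.sum_nonneg (fun _ _ => abs_nonneg _)
  have hAH := azumaHoeffding h (isPredictable_ahCoef I c K)
    (A := ahBound (∑ i ∈ I, |c i|) u) (abs_ahCoef_le h hu I c K hM) (M + 1) hlam
  refine le_trans (measure_mono (fun ω hω => ?_)) hAH
  simp only [Set.mem_setOf_eq] at hω ⊢
  rw [← err_eq_transform I c K hM ω]
  exact lt_of_le_of_lt (azumaRadius_le_envelope hS hu M lam) hω

/-! ### Lemma 3.1(2) in the floating-point regime `u ≤ 1` -/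

/-- **Lemma 3.1(2), the induction:** for `u ≤ 1`, finsets `D` and `C` with every index of `D`
below every index of `C`, `1 ≤ E[ψ_D ψ_C²] ≤ (1 + u²)^{|C|}` (induction on `max C`:
`E[Q(1+δ_m)²] = E Q + E[Qδ_m²]` with `Q = ψ_Dψ_{C∖m}² ≥ 0` because `1 + δ_k ≥ 1 − u ≥ 0`).
[cite: ArarEtAl2023, Lemma 3.1(2) proof] -/
theorem integral_prod_mul_prod_sq_bounds (h : SRErrorModel μ u δ) (hu1 : u ≤ 1) (D C : Finset ℕ)
    (hDC : ∀ j ∈ D, ∀ k ∈ C, j < k) :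
    1 ≤ ∫ ω, (∏ k ∈ D, (1 + δ k ω)) * ∏ k ∈ C, (1 + δ k ω) ^ 2 ∂μ ∧
      ∫ ω, (∏ k ∈ D, (1 + δ k ω)) * ∏ k ∈ C, (1 + δ k ω) ^ 2 ∂μ ≤ (1 + u ^ 2) ^ C.card := by
  classical
  have hu : 0 ≤ u := u_nonneg h
  -- plumbing: measurability / bounds / integrability of `ψ_D ψ_s²` and its products with `δ_m`, `δ_m²`
  have hQm : ∀ s : Finset ℕ, Measurable (fun ω => (∏ k ∈ D, (1 + δ k ω)) * ∏ k ∈ s, (1 + δ k ω) ^ 2) :=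
    fun s => (measurable_prod h D).mul (Finset.measurable_prod s (fun k _ =>
      ((h.measurable k).const_add 1).pow_const 2))
  have hQb : ∀ (s : Finset ℕ) ω, |(∏ k ∈ D, (1 + δ k ω)) * ∏ k ∈ s, (1 + δ k ω) ^ 2|
      ≤ (1 + u) ^ D.card * ((1 + u) ^ 2) ^ s.card := by
    intro s ω
    rw [abs_mul, Finset.prod_pow, abs_pow]
    exact mul_le_mul (abs_prod_le h D ω) ((pow_le_pow_left₀ (abs_nonneg _) (abs_prod_le h s ω) 2
      ).trans (le_of_eq (by rw [← pow_mul, ← pow_mul, mul_comm]))) (by positivity) (by positivity)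
  have hQi : ∀ s : Finset ℕ,
      Integrable (fun ω => (∏ k ∈ D, (1 + δ k ω)) * ∏ k ∈ s, (1 + δ k ω) ^ 2) μ :=
    fun s => integrable_of_abs_le (hQm s) (hQb s)
  have hQδi : ∀ (s : Finset ℕ) (m : ℕ),
      Integrable (fun ω => ((∏ k ∈ D, (1 + δ k ω)) * ∏ k ∈ s, (1 + δ k ω) ^ 2) * δ m ω) μ := by
    intro s m
    refine (hQi s).mul_bdd (c := u) (h.measurable m).aestronglyMeasurable (ae_of_all _ (fun ω => ?_))
    rw [Real.norm_eq_abs]; exact h.bounded m ω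
  have hQδ2i : ∀ (s : Finset ℕ) (m : ℕ),
      Integrable (fun ω => ((∏ k ∈ D, (1 + δ k ω)) * ∏ k ∈ s, (1 + δ k ω) ^ 2) * δ m ω ^ 2) μ := by
    intro s m
    refine (hQi s).mul_bdd (c := u ^ 2) ((h.measurable m).pow_const 2).aestronglyMeasurable
      (ae_of_all _ (fun ω => ?_))
    rw [Real.norm_eq_abs, abs_pow, ← sq_abs u]
    exact pow_le_pow_left₀ (abs_nonneg _) ((h.bounded m ω).trans (le_abs_self u)) 2
  have hQnn : ∀ (s : Finset ℕ) ω, 0 ≤ (∏ k ∈ D, (1 + δ k ω)) * ∏ k ∈ s, (1 + δ k ω) ^ 2 := by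
    intro s ω
    refine mul_nonneg (Finset.prod_nonneg (fun k _ => ?_)) (Finset.prod_nonneg (fun _ _ => sq_nonneg _))
    have := abs_le.mp (h.bounded k ω)
    linarith
  induction C using Finset.induction_on_max with
  | empty =>
    simp only [Finset.prod_empty, mul_one, Finset.card_empty, pow_zero]
    rw [productMeanOne_holds Ω μ u δ h D]
    exact ⟨le_rfl, le_rfl⟩
  | insert m s hlt ih =>
    have hm : m ∉ s := fun hms => lt_irrefl _ (hlt m hms)
    have hDs : ∀ j ∈ D, ∀ k ∈ s, j < k := fun j hj k hk => hDC j hj k (Finset.mem_insert_of_mem hk)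
    have hDm : ∀ j ∈ D, j < m := fun j hj => hDC j hj m (Finset.mem_insert_self m s)
    obtain ⟨ih1, ih2⟩ := ih hDs
    have hsplit : ∀ ω, (∏ k ∈ D, (1 + δ k ω)) * ∏ k ∈ insert m s, (1 + δ k ω) ^ 2
        = (((∏ k ∈ D, (1 + δ k ω)) * ∏ k ∈ s, (1 + δ k ω) ^ 2)
          + 2 * (((∏ k ∈ D, (1 + δ k ω)) * ∏ k ∈ s, (1 + δ k ω) ^ 2) * δ m ω))
          + ((∏ k ∈ D, (1 + δ k ω)) * ∏ k ∈ s, (1 + δ k ω) ^ 2) * δ m ω ^ 2 := by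
      intro ω; rw [Finset.prod_insert hm]; ring
    simp_rw [hsplit]
    -- the mixed term has mean zero by mean independence (functional of the past `D ∪ s < m`)
    have hzero : ∫ ω, ((∏ k ∈ D, (1 + δ k ω)) * ∏ k ∈ s, (1 + δ k ω) ^ 2) * δ m ω ∂μ = 0 := by
      have key := integral_pastFn_mul_eq_zero h hu m
        (F := fun v => (∏ k ∈ D, (1 + v k)) * ∏ k ∈ s, (1 + v k) ^ 2) ?_ ?_ ?_
      · simpa using key
      · exact (Finset.measurable_prod D (fun k _ => (measurable_pi_apply k).const_add 1)).mul
          (Finset.measurable_prod s (fun k _ => ((measurable_pi_apply k).const_add 1).pow_const 2))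
      · intro v w hvw
        show (∏ k ∈ D, (1 + v k)) * ∏ k ∈ s, (1 + v k) ^ 2
          = (∏ k ∈ D, (1 + w k)) * ∏ k ∈ s, (1 + w k) ^ 2
        congr 1
        · exact Finset.prod_congr rfl (fun k hk => by rw [hvw k (Set.mem_Iio.mpr (hDm k hk))])
        · exact Finset.prod_congr rfl (fun k hk => by rw [hvw k (Set.mem_Iio.mpr (hlt k hk))])
      · refine ⟨(1 + u) ^ D.card * ((1 + u) ^ 2) ^ s.card, fun v hv => ?_⟩
        show |(∏ k ∈ D, (1 + v k)) * ∏ k ∈ s, (1 + v k) ^ 2| ≤ (1 + u) ^ D.card * ((1 + u) ^ 2) ^ s.card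
        rw [abs_mul, Finset.abs_prod, Finset.abs_prod]
        refine mul_le_mul ?_ ?_ (Finset.prod_nonneg (fun _ _ => abs_nonneg _)) (by positivity)
        · calc ∏ k ∈ D, |1 + v k| ≤ ∏ _k ∈ D, (1 + u) :=
                Finset.prod_le_prod (fun _ _ => abs_nonneg _) (fun k _ =>
                  (abs_add_le 1 (v k)).trans (by rw [abs_one]; linarith [hv k]))
            _ = (1 + u) ^ D.card := Finset.prod_const _
        · calc ∏ k ∈ s, |(1 + v k) ^ 2| ≤ ∏ _k ∈ s, (1 + u) ^ 2 :=
                Finset.prod_le_prod (fun _ _ => abs_nonneg _) (fun k _ => by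
                  rw [abs_pow]
                  exact pow_le_pow_left₀ (abs_nonneg _)
                    ((abs_add_le 1 (v k)).trans (by rw [abs_one]; linarith [hv k])) 2)
            _ = ((1 + u) ^ 2) ^ s.card := Finset.prod_const _
    rw [integral_add ?i1 (hQδ2i s m), integral_add (hQi s) ((hQδi s m).const_mul 2),
      integral_const_mul, hzero, mul_zero, add_zero]
    case i1 => exact (hQi s).add ((hQδi s m).const_mul 2)
    -- `0 ≤ ∫ Qδ_m² ≤ u² ∫ Q`
    have hlow : 0 ≤ ∫ ω, ((∏ k ∈ D, (1 + δ k ω)) * ∏ k ∈ s, (1 + δ k ω) ^ 2) * δ m ω ^ 2 ∂μ :=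
      integral_nonneg (fun ω => mul_nonneg (hQnn s ω) (sq_nonneg _))
    have hup : ∫ ω, ((∏ k ∈ D, (1 + δ k ω)) * ∏ k ∈ s, (1 + δ k ω) ^ 2) * δ m ω ^ 2 ∂μ
        ≤ ∫ ω, u ^ 2 * ((∏ k ∈ D, (1 + δ k ω)) * ∏ k ∈ s, (1 + δ k ω) ^ 2) ∂μ := by
      refine integral_mono (hQδ2i s m) ((hQi s).const_mul _) (fun ω => ?_)
      have hd : δ m ω ^ 2 ≤ u ^ 2 := by
        rw [← sq_abs, ← sq_abs u]
        exact pow_le_pow_left₀ (abs_nonneg _) ((h.bounded m ω).trans (le_abs_self u)) 2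
      calc ((∏ k ∈ D, (1 + δ k ω)) * ∏ k ∈ s, (1 + δ k ω) ^ 2) * δ m ω ^ 2
          ≤ ((∏ k ∈ D, (1 + δ k ω)) * ∏ k ∈ s, (1 + δ k ω) ^ 2) * u ^ 2 :=
            mul_le_mul_of_nonneg_left hd (hQnn s ω)
        _ = u ^ 2 * ((∏ k ∈ D, (1 + δ k ω)) * ∏ k ∈ s, (1 + δ k ω) ^ 2) := mul_comm _ _
    rw [integral_const_mul] at hup
    rw [Finset.card_insert_of_notMem hm, pow_succ]
    have hI0 : 0 ≤ ∫ ω, (∏ k ∈ D, (1 + δ k ω)) * ∏ k ∈ s, (1 + δ k ω) ^ 2 ∂μ :=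
      integral_nonneg (fun ω => hQnn s ω)
    constructor
    · linarith
    · nlinarith [sq_nonneg u]

/-- **Lemma 3.1(2) (covariance of two error products) in the regime `u ≤ 1`** of the source (where
`u` is the unit roundoff): if every index of `K △ K'` precedes every index of `K ∩ K'`, then
`0 ≤ E(ψ_Kψ_{K'}) − 1 ≤ γ_m(u²)`, `m = |K ∩ K'|`. Pointwise `ψ_Kψ_{K'} = ψ_{K△K'} ψ_{K∩K'}²`, then
`integral_prod_mul_prod_sq_bounds`. [cite: ArarEtAl2023, Lemma 3.1(2)] -/
theorem productCovarianceBound_of_le_one (h : SRErrorModel μ u δ) (hu1 : u ≤ 1) (K K' : Finset ℕ)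
    (hord : ∀ j ∈ symmDiff K K', ∀ k ∈ K ∩ K', j < k) :
    0 ≤ (∫ ω, (∏ k ∈ K, (1 + δ k ω)) * ∏ k ∈ K', (1 + δ k ω) ∂μ) - 1 ∧
      (∫ ω, (∏ k ∈ K, (1 + δ k ω)) * ∏ k ∈ K', (1 + δ k ω) ∂μ) - 1 ≤ gammaSq (K ∩ K').card u := by
  classical
  have hpt : ∀ ω, (∏ k ∈ K, (1 + δ k ω)) * ∏ k ∈ K', (1 + δ k ω)
      = (∏ k ∈ symmDiff K K', (1 + δ k ω)) * ∏ k ∈ K ∩ K', (1 + δ k ω) ^ 2 := by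
    intro ω
    have hK : ∏ k ∈ K, (1 + δ k ω)
        = (∏ k ∈ K \ K', (1 + δ k ω)) * ∏ k ∈ K ∩ K', (1 + δ k ω) := by
      rw [← Finset.prod_union (Finset.disjoint_sdiff_inter K K'), Finset.sdiff_union_inter]
    have hd : Disjoint (K' \ K) (K ∩ K') := by
      rw [Finset.inter_comm]; exact Finset.disjoint_sdiff_inter K' K
    have hK' : ∏ k ∈ K', (1 + δ k ω)
        = (∏ k ∈ K' \ K, (1 + δ k ω)) * ∏ k ∈ K ∩ K', (1 + δ k ω) := by
      rw [← Finset.prod_union hd, Finset.inter_comm, Finset.sdiff_union_inter]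
    rw [hK, hK', Finset.symmDiff_def, Finset.prod_union disjoint_sdiff_sdiff, Finset.prod_pow]
    ring
  simp_rw [hpt]
  obtain ⟨h1, h2⟩ := integral_prod_mul_prod_sq_bounds h hu1 (symmDiff K K') (K ∩ K') hord
  refine ⟨by linarith, ?_⟩
  unfold gammaSq
  linarith

end Model

/-! ### The inner product of §3.1 as a recursive sum -/

/-- The index set of the `i`-th term of `ŷ`: `Kᵢ = {2i−2} ∪ {2k−1 : i ≤ k ≤ n}` for `i ≥ 2` and
`K₁ = {2k−1 : 1 ≤ k ≤ n}` (the convention `δ₀ = 0` removes the fictitious factor).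
[cite: ArarEtAl2023, §3.1 / Thm. 3.2 proof] -/
def ipIndex (n i : ℕ) : Finset ℕ :=
  (if i = 1 then ∅ else {2 * i - 2}) ∪ (Icc i n).image (fun k => 2 * k - 1)

/-- **`ŷ = Σ_{i=1}^{n} aᵢbᵢ ψ_{Kᵢ}`.** [cite: ArarEtAl2023, §3.1 / Thm. 3.2 proof] -/
theorem ipComputed_eq_sum_prod (n : ℕ) (a b : ℕ → ℝ) (e : ℕ → ℝ) :
    ipComputed n a b e = ∑ i ∈ Icc 1 n, (a i * b i) * ∏ k ∈ ipIndex n i, (1 + e k) := by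
  unfold ipComputed
  refine Finset.sum_congr rfl (fun i hi => ?_)
  have hi1 : 1 ≤ i := (Finset.mem_Icc.mp hi).1
  rw [mul_assoc]
  congr 1
  have hdisj : Disjoint (if i = 1 then ∅ else ({2 * i - 2} : Finset ℕ))
      ((Icc i n).image (fun k => 2 * k - 1)) := by
    split_ifs with h1
    · exact disjoint_empty_left _
    · refine Finset.disjoint_left.mpr (fun x hx hx' => ?_)
      rw [Finset.mem_singleton] at hx
      obtain ⟨k, hk, hkx⟩ := Finset.mem_image.mp hx'
      have := (Finset.mem_Icc.mp hk).1
      omega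
  have hinj : Set.InjOn (fun k => 2 * k - 1) ↑(Icc i n) := by
    intro k hk k' hk' hkk'
    have h1 := (Finset.mem_Icc.mp (Finset.mem_coe.mp hk)).1
    have h2 := (Finset.mem_Icc.mp (Finset.mem_coe.mp hk')).1
    simp only at hkk'
    omega
  rw [ipIndex, Finset.prod_union hdisj, Finset.prod_image hinj]
  congr 1
  by_cases h1 : i = 1
  · subst h1; simp [withZero]
  · rw [if_neg h1, Finset.prod_singleton, withZero, if_neg (by omega)]

/-- `|Kᵢ| ≤ n` for `1 ≤ i ≤ n`. [cite: ArarEtAl2023, Thm. 3.2 proof (`γ_{n−i+2} ≤ γ_n`)] -/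
theorem card_ipIndex_le {n i : ℕ} (hi : i ∈ Icc 1 n) : (ipIndex n i).card ≤ n := by
  obtain ⟨hi1, hin⟩ := Finset.mem_Icc.mp hi
  unfold ipIndex
  refine (Finset.card_union_le _ _).trans ?_
  have himg : ((Icc i n).image (fun k => 2 * k - 1)).card ≤ n + 1 - i :=
    Finset.card_image_le.trans (by rw [Nat.card_Icc])
  split_ifs with h1
  · rw [Finset.card_empty]; omega
  · rw [Finset.card_singleton]; omega

/-- `|Kᵢ| ≤ 2n` for the Horner index sets `Kᵢ = [max(1, 2(n−i)), 2n]`.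
[cite: ArarEtAl2023, Thm. 3.5 proof (`γ_{2i} ≤ γ_{2n}`)] -/
theorem card_hornerIndex_le (n i : ℕ) : (Icc (max 1 (2 * (n - i))) (2 * n)).card ≤ 2 * n := by
  rw [Nat.card_Icc]; omega

/-- `Kᵢ ⊆ [1, 2n]` for the Horner index sets. [cite: ArarEtAl2023, Model 3.4] -/
theorem hornerIndex_subset (n i : ℕ) : Icc (max 1 (2 * (n - i))) (2 * n) ⊆ Icc 1 (2 * n) :=
  Finset.Icc_subset_Icc (le_max_left _ _) le_rfl

/-! ### The discharges -/

/-- **Theorem 3.2, first part, holds in the SR error model** (discharge of `innerProductUnbiased`):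
`E ŷ = y`. [cite: ArarEtAl2023, Thm. 3.2] -/
theorem innerProductUnbiased_holds : innerProductUnbiased := by
  intro Ω _ μ _ u δ h n a b
  simp_rw [ipComputed_eq_sum_prod]
  exact integral_sum_mul_prod h (Icc 1 n) (fun i => a i * b i) (ipIndex n)

/-- **Theorem 3.2, eq. (3.1), holds in the SR error model** (discharge of
`innerProductVarianceBound`): `E(ŷ − y)² ≤ (Σ|aᵢbᵢ|)² γ_n(u²)`. [cite: ArarEtAl2023, Thm. 3.2 eq. (3.1)] -/
theorem innerProductVarianceBound_holds : innerProductVarianceBound := by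
  intro Ω _ μ _ u δ h n a b
  simp_rw [ipComputed_eq_sum_prod]
  exact integral_errSq_le h (Icc 1 n) (fun i => a i * b i) (ipIndex n) (fun i hi => card_ipIndex_le hi)

/-- **Theorem 3.5, first part, holds in the SR error model** (discharge of `hornerUnbiased`):
`E r̂_{2n} = P(x)` — CHM21's recursive-sum unbiasedness. [cite: ArarEtAl2023, Thm. 3.5] -/
theorem hornerUnbiased_holds : hornerUnbiased := by
  intro Ω _ μ _ u δ h n a x
  exact recursiveSumUnbiased_holds Ω μ u δ h (n + 1) (fun i => a i * x ^ i)
    (fun i => Icc (max 1 (2 * (n - i))) (2 * n))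

/-- **Theorem 3.5, eq. (3.2), holds in the SR error model** (discharge of `hornerVarianceBound`):
`E(P̂(x) − P(x))² ≤ (Σ|aᵢxⁱ|)² γ_{2n}(u²)`. [cite: ArarEtAl2023, Thm. 3.5 eq. (3.2)] -/
theorem hornerVarianceBound_holds : hornerVarianceBound := by
  intro Ω _ μ _ u δ h n a x
  exact integral_errSq_le h (range (n + 1)) (fun i => a i * x ^ i)
    (fun i => Icc (max 1 (2 * (n - i))) (2 * n)) (fun i _ => card_hornerIndex_le n i)

/-- **Eq. (4.4) holds in the SR error model** (discharge of `innerProductBoundBC`).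
[cite: ArarEtAl2023, §4.2.1 eq. (4.4)] -/
theorem innerProductBoundBC_holds : innerProductBoundBC := by
  intro Ω _ μ _ u δ h n a b lam hlam _
  simp_rw [ipComputed_eq_sum_prod]
  exact measure_err_gt_le_BC h (Icc 1 n) (fun i => a i * b i) (ipIndex n)
    (fun i hi => card_ipIndex_le hi) hlam

/-- **Eq. (4.5) holds in the SR error model** (discharge of `hornerBoundBC`).
[cite: ArarEtAl2023, §4.2.2 eq. (4.5)] -/
theorem hornerBoundBC_holds : hornerBoundBC := by
  intro Ω _ μ _ u δ h n a x lam hlam _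
  exact measure_err_gt_le_BC h (range (n + 1)) (fun i => a i * x ^ i)
    (fun i => Icc (max 1 (2 * (n - i))) (2 * n)) (fun i _ => card_hornerIndex_le n i) hlam

/-- **Theorem 4.5 holds in the SR error model** (discharge of `hornerBoundAH`): with probability at
least `1 − λ`, `|P̂(x) − P(x)| ≤ (Σ|aᵢxⁱ|) √(uγ_{4n}(u)) √(ln(2/λ))`. The hypotheses `0 < u < 1` of
the named fact are not needed (`0 ≤ u` follows from the model). [cite: ArarEtAl2023, Thm. 4.5] -/
theorem hornerBoundAH_holds : hornerBoundAH := by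
  intro Ω _ μ _ u δ _ _ h n a x lam hlam _
  have h4 : 4 * n = 2 * (2 * n) := by ring
  simp_rw [hornerEnvelopeAH, h4]
  exact measure_err_gt_le_AH h (range (n + 1)) (fun i => a i * x ^ i)
    (fun i => Icc (max 1 (2 * (n - i))) (2 * n)) (fun i _ => hornerIndex_subset n i) hlam

/-! ### The unrestricted transcription of Lemma 3.1(2) is false (witness at `u = 2`) -/

/-- [cite: ArarEtAl2023, Lemma 3.1(2)] (witness against the transcription for `u > 1`): the errors
`δ₀ = (−2,−2,2,2)`, `δ₁ = (−2,2,0,0)`, `δ_k = 0` (`k ≥ 2`) on four equally likely atoms. -/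
private def cexDelta : ℕ → Fin 4 → ℝ
  | 0 => ![-2, -2, 2, 2]
  | 1 => ![-2, 2, 0, 0]
  | _ + 2 => fun _ => 0

/-- [cite: ArarEtAl2023, Lemma 3.1(2)] (witness): the uniform law on the four atoms. -/
private noncomputable def cexMeasure : Measure (Fin 4) := (PMF.uniformOfFintype (Fin 4)).toMeasure

/-- [folklore] the witness law is a probability measure. -/
private instance : IsProbabilityMeasure cexMeasure := by
  unfold cexMeasure; infer_instance

/-- [folklore] integrals against the witness law are averages over the four atoms. -/
private theorem cex_integral (f : Fin 4 → ℝ) :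
    ∫ ω, f ω ∂cexMeasure = 4⁻¹ * (f 0 + f 1 + f 2 + f 3) := by
  rw [cexMeasure, PMF.integral_eq_sum]
  simp [PMF.uniformOfFintype_apply, Fin.sum_univ_four]
  ring

/-- [cite: ArarEtAl2023, Def. 2.1 / Lemma 2.3] the witness IS an SR error model with `u = 2`
(bounded by `2`, mean zero, and `δ₁` mean independent of `δ₀`: given `δ₀ = −2` it is `±2` with equal
odds, given `δ₀ = 2` it vanishes). -/
private theorem cex_model : SRErrorModel cexMeasure 2 cexDelta where
  measurable k := measurable_of_finite _
  bounded k ω := by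
    match k with
    | 0 => fin_cases ω <;> simp [cexDelta]
    | 1 => fin_cases ω <;> simp [cexDelta]
    | k + 2 => simp [cexDelta]
  meanIndep k g _ _ := by
    match k with
    | 0 =>
      have hc : ∀ ω : Fin 4, (fun i : Fin 0 => cexDelta i ω) = (fun i : Fin 0 => cexDelta i 0) :=
        fun ω => funext (fun i => i.elim0)
      simp_rw [hc]
      rw [cex_integral]
      simp [cexDelta]
    | 1 =>
      have h10 : (fun i : Fin 1 => cexDelta i (1 : Fin 4)) = (fun i : Fin 1 => cexDelta i 0) := by
        funext i; fin_cases i; simp [cexDelta]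
      rw [cex_integral]
      simp only [h10]
      simp [cexDelta]
    | k + 2 => simp [cexDelta]

/-- [cite: ArarEtAl2023, Lemma 3.1(2)] (witness): `E[ψ_{{0,1}} ψ_{{1}}] = E[(1+δ₀)(1+δ₁)²] = −1`. -/
private theorem cex_value :
    ∫ ω, (∏ k ∈ ({0, 1} : Finset ℕ), (1 + cexDelta k ω)) * ∏ k ∈ ({1} : Finset ℕ), (1 + cexDelta k ω)
      ∂cexMeasure = -1 := by
  rw [cex_integral]
  simp [Finset.prod_insert, cexDelta]
  norm_num

/-- **The unrestricted transcription `productCovarianceBound` is false.** It quantifies over all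
`u : ℝ`, and for `u = 2` the mean-independent witness above has `Cov(ψ_K, ψ_{K'}) = −2 < 0` for
`K = {0,1}`, `K' = {1}` (ordering hypothesis: `0 < 1`). The published Lemma 3.1(2) concerns the unit
roundoff `u ≤ 1` and is `productCovarianceBound_of_le_one`. [cite: ArarEtAl2023, Lemma 3.1(2)] -/
theorem not_productCovarianceBound : ¬ productCovarianceBound := by
  intro hP
  have hord : ∀ j ∈ symmDiff ({0, 1} : Finset ℕ) {1}, ∀ k ∈ ({0, 1} : Finset ℕ) ∩ {1}, j < k := by
    intro j hj k hk
    rw [Finset.mem_symmDiff] at hj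
    simp only [Finset.mem_insert, Finset.mem_singleton, Finset.mem_inter] at hj hk
    omega
  have h := (hP (Fin 4) cexMeasure 2 cexDelta cex_model {0, 1} {1} hord).1
  rw [cex_value] at h
  norm_num at h

end Literature.ComputerArithmetic.ElararEtAl2023
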